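import Mathlib
import HarnessLib
import Summits.HubbardSuperconductivity.HubbardSuperconductivity.Theorems.KLProgrammeKLRegimeEngineSliceFamBandTelClosed
import Summits.HubbardSuperconductivity.HubbardSuperconductivity.Theorems.KLProgrammeKLRegimeSectorSliceCovDefectSectional
import Summits.HubbardSuperconductivity.HubbardSuperconductivity.Theorems.KLProgrammeKLRegimeTwoVolumeTowerSectionalStepScalars

/-!
# K3 VL child `KLRegimeVolumeLimitV17F2` (stmt-HubbardSuperconductivity-20440), located item #23 «W2-HALF-VL», COV/SEC shallow half, part 2CS: the SECTIONAL
# COVARIANCE piece of one step of the frame telescope in the decaying currency — symbol-class level, the `(1 + Λ_w·tnorm)`-weighted SECTIONAL rows of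
# `S(F̃[K_o])ᵀ(C^{K_n} − C^{K_o})S(F̃[K_o])` for two admissible frames whose band increment has the jets of ONE flow piece at depth `4^i`, `Λ_w·4^i ≤ 1`:
# `≤ 𝒦·G₀/(Λ_{m+1+j}²·4^i)` — ε-FREE, `𝒦` ABSOLUTE

Cell `gate-hubbard-kl`, seat p3 (g16), lead of #23.  The fixed-time twin of part 2C (`covStep_decay_le`): brick S4 `secRowWt_sliceCT_covDefect_pieceJets_le`
(reference scale `x₀ := 4^i`, `D_w := 4^{−i}`, `s₀ := 1` in `Ŵ`; SECTIONAL amplitude = `covTel_amp_pack`'s full one minus its nonnegative time term,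
`le_of_add_six_le`), and the scalar reduction `secCov_scalar_le` / `sqrt_secCellCount_le` / `telW_ref_le`.

* **`covStepSec_decay_le`** — the sectional rows `≤ 𝒦·G₀/(klScale klE0 (m+1+j)²·4^i)` for every `X, t, ℓ`, every `0 ≤ Λ_w` with `Λ_w·4^i ≤ ρ_w`.

Everything is proved; no definitions, no sorry.  Nothing asserts any stub, K3, VL or superconductivity. [cite: BenfattoGiulianiMastropietro2006, §2.8 (2.81), §3 (3.2)–(3.8)]
-/

noncomputable section

namespace Summit.HubbardSuperconductivity.HubbardSuperconductivity.Theorems.TorusFourierL2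

set_option linter.dupNamespace false -- summit = problem name (single-conjunct summit), D-0017

open Set Finset Literature.MathematicalPhysics.QuantumLattice Literature.MathematicalPhysics.QuantumLattice.BandSectorCounting Literature.Probability.LatticeModels
open Literature.MathematicalPhysics.QuantumLattice.FermiRG Literature.Analysis.SpecialFunctions Summit.HubbardSuperconductivity.HubbardSuperconductivity.Theorems.DispersionFlow
open Summit.HubbardSuperconductivity.HubbardSuperconductivity.Theorems.KLRegimeSplit Summit.HubbardSuperconductivity.HubbardSuperconductivity.Theorems.KLProgrammeLegKernels
open Summit.HubbardSuperconductivity.HubbardSuperconductivity.Theorems.PerturbedFermiCurve Summit.HubbardSuperconductivity.HubbardSuperconductivity.Theorems.KLRegimeWick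
open scoped Real Nat

set_option maxHeartbeats 8000000 in
/-- **The SECTIONAL covariance piece of one telescope step in the decaying currency, symbol-class level** (module docstring). [cite: BenfattoGiulianiMastropietro2006, §3 (3.2)–(3.8)] -/
theorem covStepSec_decay_le (ha : (-4 : ℝ) < -(6 / 5)) (hab : (-(6 / 5) : ℝ) ≤ -(1 / 10)) (hb : (-(1 / 10) : ℝ) < 0) (j : ℕ) :
    ∃ 𝒦 ρw : ℝ, 0 ≤ 𝒦 ∧ 0 < ρw ∧ ∀ (R : RenConsts), (∀ i, 0 ≤ R.Gfr i) → ∀ (c U : ℝ), 0 < c →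
      c ≤ min (min ((bandBounds ha hab hb).Dtmin / 4) ((bandBounds ha hab hb).rhomin / 4)) (1 / 40) / (12 * (R.Gfr 2 + 1)) → 0 < U →
      U ≤ min 1 (min (min ((bandBounds ha hab hb).Dtmin / 4) ((bandBounds ha hab hb).rhomin / 4)) (1 / 40) / (24 * (R.Gfr 0 + R.Gfr 1 + 1))) → R.Gfr 3 * U ≤ 1 →
      ∀ β : ℝ, klBetaMin ≤ β → β ≤ Real.exp (c / U ^ 2) → ∀ μ ∈ klWindowC, ∀ (L M : ℕ) [NeZero L] [NeZero M], β ^ 2 ≤ (L : ℝ) → β ≤ (M : ℝ) →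
      ∀ (Ko Kn : TrigPolyC4v) (i : ℕ), FrameOK R U (nScales β) μ Ko → FrameOK R U (nScales β) μ Kn →
        (∀ p : Momentum, ‖iteratedFDeriv ℝ 3 (frameShift Ko) p‖ ≤ R.Gfr 3 * U ^ 2 * ((4 : ℝ) ^ i / 3)) →
        (∀ p : Momentum, ‖iteratedFDeriv ℝ 3 (frameShift Kn) p‖ ≤ R.Gfr 3 * U ^ 2 * ((4 : ℝ) ^ (i + 1) / 3)) →
        (∀ p : Momentum, ‖iteratedFDeriv ℝ 3 (frameLevel μ Ko) p‖ ≤ 64 + R.Gfr 3 * U ^ 2 * ((4 : ℝ) ^ i / 3)) →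
        (∀ p : Momentum, ‖iteratedFDeriv ℝ 3 (frameLevel μ Kn) p‖ ≤ 64 + R.Gfr 3 * U ^ 2 * ((4 : ℝ) ^ (i + 1) / 3)) →
      ∀ G₀ : ℝ, 0 < G₀ → G₀ ≤ 1 → (∀ p : Momentum, |frameLevel μ Kn p - frameLevel μ Ko p| ≤ G₀ / ((4 : ℝ) ^ i) ^ 2) →
        (∀ p : Momentum, ‖fderiv ℝ (fun q : Momentum => frameLevel μ Kn q - frameLevel μ Ko q) p‖ ≤ G₀ / (4 : ℝ) ^ i) →
        (∀ p : Momentum, ‖iteratedFDeriv ℝ 2 (fun q : Momentum => frameLevel μ Kn q - frameLevel μ Ko q) p‖ ≤ G₀) →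
        (∀ p : Momentum, ‖iteratedFDeriv ℝ 3 (fun q : Momentum => frameLevel μ Kn q - frameLevel μ Ko q) p‖ ≤ G₀ * (4 : ℝ) ^ i) →
      ∀ m : ℕ, m + 1 + j ≤ nScales β + 1 → (4 : ℝ) ^ (j + 4) * (16 : ℝ) ^ (m + 1) ≤ (4 : ℝ) ^ i → ∀ Λw : ℝ, 0 ≤ Λw → Λw * (4 : ℝ) ^ i ≤ ρw →
        ∀ (X : SpaceTimeIdx L M × SectorLeg (sectorCount (m + 1))) (t : ImagTimeIdx M) (ℓ : SectorLeg (sectorCount (m + 1))),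
          ∑ y : TorusSite 2 L,
            ‖((sectorSubMatrix L M β (bgmFatMultiplier L M klE0 β (nambuXiCT L μ Ko) (m + 1))).transpose *
                (hubbardCovSliceCT L M β μ 0 Kn (klScale klE0 (m + 1 + j)) (klScale klE0 (m + j)) - hubbardCovSliceCT L M β μ 0 Ko (klScale klE0 (m + 1 + j)) (klScale klE0 (m + j))) *
                sectorSubMatrix L M β (bgmFatMultiplier L M klE0 β (nambuXiCT L μ Ko) (m + 1))) X ((t, y), ℓ)‖ * (1 + Λw * (Torus.tnorm (X.1.2 - y) : ℝ)) ≤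
            𝒦 * G₀ / (klScale klE0 (m + 1 + j) ^ 2 * (4 : ℝ) ^ i) := by
  -- the window band bounds, `κ₀`, `A := κ₀/4` (as in `alphaWt_klSliceCov_bgmFat_of_thresholds`)
  set B : BandBounds (-(6 / 5)) (-(1 / 10)) := bandBounds ha hab hb with hBdef
  set κ₀ : ℝ := min (min (B.Dtmin / 4) (B.rhomin / 4)) (1 / 40) with hκ₀
  have hDt := B.Dtmin_pos; have hrh := B.rhomin_pos
  have hκ₀pos : 0 < κ₀ := by rw [hκ₀]; exact lt_min (lt_min (by positivity) (by positivity)) (by norm_num)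
  have hκ₀Dt : κ₀ ≤ B.Dtmin / 4 := (min_le_left _ _).trans (min_le_left _ _)
  have hκ₀rh : κ₀ ≤ B.rhomin / 4 := (min_le_left _ _).trans (min_le_right _ _)
  have hκ₀40 : κ₀ ≤ 1 / 40 := min_le_right _ _
  have hrh2 : B.rhomin ≤ 2 := by
    have : B.rhomin = cRhomin (-(6 / 5)) (-(1 / 10)) := rfl
    rw [this]; exact cRhomin_le_two (by norm_num) (by norm_num)
  have he : (0 : ℝ) < klE0 := by norm_num [klE0]
  have he1 : klE0 ≤ 1 := by norm_num [klE0]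
  obtain ⟨d₀, hd₀, hd₀1, hd₀2, hd₀3, hd₀4⟩ := exists_abs_derivs4_bgmCutoffSq_le he
  obtain ⟨B₀, hB₀0, hB₀⟩ := exists_norm_iteratedDeriv_sectorWeightCirc_polarAngle_line_le 2
  obtain ⟨B₃a, hB₃a0, hB₃a⟩ := exists_norm_iteratedDeriv_sectorWeightCirc_polarAngle_line_le 3
  set A : ℝ := κ₀ / 4 with hAdef
  have hA0 : 0 < A := by rw [hAdef]; positivity
  have hDtA : 0 < B.Dtmin - 2 * A := by rw [hAdef]; linarith
  have hγ : 0 < 2 * B.rhomin - 4 * A := by rw [hAdef]; linarith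
  have hγ4 : 2 * B.rhomin - 4 * A ≤ 4 := by linarith
  have hsm := B.smax_pos; have hπ := Real.pi_pos; have hπ3 := Real.pi_gt_three
  -- the fixed scale-free constants of the telescope
  obtain ⟨cρ, hcρ⟩ : ∃ y : ℝ, y = (2 * klE0 / π + B.smax * B.Dtmin * (3 / 4)) / (B.Dtmin - 2 * A) + π * Real.sqrt 2 * (1 + (4 + 2 * A) / (B.Dtmin - 2 * A)) := ⟨_, rfl⟩
  obtain ⟨ρfM, hρfM⟩ : ∃ y : ℝ, y = (klE0 + B.smax * B.Dtmin * (3 * (π / 2) / 4)) / (B.Dtmin - 2 * A) + π * Real.sqrt 2 * (1 + (4 + 2 * A) / (B.Dtmin - 2 * A)) * (π / 2) :=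
    ⟨_, rfl⟩
  have hcρ0 : 0 < cρ := by rw [hcρ]; positivity
  have hρfM0 : 0 ≤ ρfM := by rw [hρfM]; positivity
  obtain ⟨ρ, hρ⟩ : ∃ y : ℝ, y = 1 := ⟨_, rfl⟩
  obtain ⟨ρ₃, hρ₃⟩ : ∃ y : ℝ, y = 1 := ⟨_, rfl⟩
  obtain ⟨σ, hσ⟩ : ∃ y : ℝ, y = 1 := ⟨_, rfl⟩
  have hρ0 : 0 < ρ := by rw [hρ]; exact one_pos
  have hρ₃0 : 0 < ρ₃ := by rw [hρ₃]; exact one_pos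
  have hσ0 : 0 < σ := by rw [hσ]; exact one_pos
  have hσ1 : σ ≤ 1 := by rw [hσ]
  obtain ⟨𝒜c, h𝒜c⟩ : ∃ y : ℝ, y = ( (16 * (32 / 3) + 16) + π ^ 3 * σ ^ 3 * ((128 * 3960000 + 1216 * 44900 + 6912 * (448 / 3 * Real.exp 2) + 26112 * (32 / 3) + 24576) + 3 * (2 * (d₀ *
      klE0 ^ 2 * 1 + 1 * (d₀ * klE0 ^ 2))) * (64 * 44900 + 416 * (448 / 3 * Real.exp 2) + 1600 * (32 / 3) + 1536) + 3 * (4 * (d₀ * klE0 ^ 4 * 1 + 2 *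
      (d₀ * klE0 ^ 2) * (d₀ * klE0 ^ 2) + 1 * (d₀ * klE0 ^ 4)) + 2 * (d₀ * klE0 ^ 2 * 1 + 1 * (d₀ * klE0 ^ 2))) * (32 * (448 / 3 * Real.exp 2) + 128 *
      (32 / 3) + 128) + (8 * (d₀ * klE0 ^ 6 * 1 + 3 * (d₀ * klE0 ^ 4) * (d₀ * klE0 ^ 2) + 3 * (d₀ * klE0 ^ 2) * (d₀ * klE0 ^ 4) + 1 * (d₀ * klE0 ^ 6))
      + 12 * (d₀ * klE0 ^ 4 * 1 + 2 * (d₀ * klE0 ^ 2) * (d₀ * klE0 ^ 2) + 1 * (d₀ * klE0 ^ 4))) * (16 * (32 / 3) + 16)) + ρ ^ 3 / 64 * ( ((Real.sqrt 2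
      * (2 * π)) ^ 3 * ((128 * 3960000 + 1408 * 44900 + 7776 * (448 / 3 * Real.exp 2) + 27648 * (32 / 3) + 24576) * (7 + (1 : ℝ) * (1 : ℝ)) ^ 3 + (64
      * 44900 + 480 * (448 / 3 * Real.exp 2) + 1728 * (32 / 3) + 1536) * (1 : ℝ) * (3 * 7 ^ 2 + 3 * 7 * ((1 : ℝ) * (1 : ℝ)) + ((1 : ℝ) * (1 : ℝ)) ^ 2)
      + 3 * ((64 * 44900 + 480 * (448 / 3 * Real.exp 2) + 1728 * (32 / 3) + 1536) * ((7 + (1 : ℝ) * (1 : ℝ)) * (7 + (1 : ℝ) * (1 : ℝ))) + (32 * (448 /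
      3 * Real.exp 2) + 144 * (32 / 3) + 128) * (7 * (1 : ℝ) + (1 : ℝ) * 7 + (1 : ℝ) * (1 : ℝ) * (1 : ℝ))) + ((32 * (448 / 3 * Real.exp 2) + 144 * (32
      / 3) + 128) * ((64 + 1 / 3) + (1 : ℝ) * (1 : ℝ)) + (16 * (32 / 3) + 16) * (1 : ℝ))) + 3 * ((2 * (d₀ * klE0 ^ 2 * 1 + 1 * (d₀ * klE0 ^ 2)) * ((4
      + 2 * A) * (2 * π) + (4 + 4 * A) * (ρfM + 4 * π) * (2 * π)) + 9 * (4 * B₀ * ((1 + 2 * (2 * klE0 / π)) * (2 * (2 * π)))))) * (2 * (2 * π) ^ 2) *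
      ((64 * 44900 + 480 * (448 / 3 * Real.exp 2) + 1728 * (32 / 3) + 1536) * (7 + (1 : ℝ) * (1 : ℝ)) ^ 2 + (32 * (448 / 3 * Real.exp 2) + 144 * (32 /
      3) + 128) * (1 : ℝ) * (2 * 7 + (1 : ℝ) * (1 : ℝ)) + (32 * (448 / 3 * Real.exp 2) + 144 * (32 / 3) + 128) * (7 + (1 : ℝ) * (1 : ℝ)) + (16 * (32 /
      3) + 16) * (1 : ℝ)) + 3 * (((4 * (d₀ * klE0 ^ 4 * 1 + 2 * (d₀ * klE0 ^ 2) * (d₀ * klE0 ^ 2) + 1 * (d₀ * klE0 ^ 4)) + 2 * (d₀ * klE0 ^ 2 * 1 + 1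
      * (d₀ * klE0 ^ 2))) * ((4 + 2 * A) * (2 * π) + (4 + 4 * A) * (ρfM + 4 * π) * (2 * π)) ^ 2 + 2 * (d₀ * klE0 ^ 2 * 1 + 1 * (d₀ * klE0 ^ 2)) * ((4
      + 4 * A) * (2 * π) ^ 2) + 4 * (d₀ * klE0 ^ 2 * 1 + 1 * (d₀ * klE0 ^ 2)) * ((4 + 2 * A) * (2 * π) + (4 + 4 * A) * (ρfM + 4 * π) * (2 * π)) * (9 *
      (4 * B₀ * ((1 + 2 * (2 * klE0 / π)) * (2 * (2 * π))))) + 9 * (4 * B₀ * ((1 + 2 * (2 * klE0 / π)) * (2 * (2 * π))) ^ 2 + 8 * B₀ ^ 2 * ((1 + 2 *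
      (2 * klE0 / π)) * (2 * (2 * π))) ^ 2))) * (Real.sqrt 2 * (2 * π)) * ((32 * (448 / 3 * Real.exp 2) + 144 * (32 / 3) + 128) * (7 + (1 : ℝ) * (1 :
      ℝ)) + (16 * (32 / 3) + 16) * (1 : ℝ)) + (((8 * (d₀ * klE0 ^ 6 * 1 + 3 * (d₀ * klE0 ^ 4) * (d₀ * klE0 ^ 2) + 3 * (d₀ * klE0 ^ 2) * (d₀ * klE0 ^
      4) + 1 * (d₀ * klE0 ^ 6)) + 12 * (d₀ * klE0 ^ 4 * 1 + 2 * (d₀ * klE0 ^ 2) * (d₀ * klE0 ^ 2) + 1 * (d₀ * klE0 ^ 4))) * (4 + 2 * A) ^ 3 + (12 *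
      (d₀ * klE0 ^ 4 * 1 + 2 * (d₀ * klE0 ^ 2) * (d₀ * klE0 ^ 2) + 1 * (d₀ * klE0 ^ 4)) + 6 * (d₀ * klE0 ^ 2 * 1 + 1 * (d₀ * klE0 ^ 2))) * (4 + 2 * A)
      * (4 + 4 * A) * klE0 + 2 * (d₀ * klE0 ^ 2 * 1 + 1 * (d₀ * klE0 ^ 2)) * (4 * klE0 ^ 2) + 216 * 9 * B₃a * ((4 * (d₀ * klE0 ^ 4 * 1 + 2 * (d₀ *
      klE0 ^ 2) * (d₀ * klE0 ^ 2) + 1 * (d₀ * klE0 ^ 4)) + 2 * (d₀ * klE0 ^ 2 * 1 + 1 * (d₀ * klE0 ^ 2))) * (4 + 2 * A) ^ 2 * (2 * klE0) + 2 * (d₀ *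
      klE0 ^ 2 * 1 + 1 * (d₀ * klE0 ^ 2)) * (4 + 4 * A) * klE0 * (2 * klE0)) + 216 * 9 * (d₀ * klE0 ^ 2 * 1 + 1 * (d₀ * klE0 ^ 2)) * (4 + 2 * A) * (12
      * B₃a + 72 * B₃a ^ 2) * (2 * klE0) ^ 2 + 216 * 9 * (12 * B₃a + 216 * B₃a ^ 2) * (2 * klE0) ^ 3) + 16 * (d₀ * klE0 ^ 2 * 1 + 1 * (d₀ * klE0 ^ 2))
      * (1 / 3 : ℝ)) * (2 * π) ^ 3 * (16 * (32 / 3) + 16)) + ((Real.sqrt 2 * (5 * π)) ^ 3 * ((128 * 3960000 + 1408 * 44900 + 7776 * (448 / 3 *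
      Real.exp 2) + 27648 * (32 / 3) + 24576) * (7 + (1 : ℝ) * (1 : ℝ)) ^ 3 + (64 * 44900 + 480 * (448 / 3 * Real.exp 2) + 1728 * (32 / 3) + 1536) *
      (1 : ℝ) * (3 * 7 ^ 2 + 3 * 7 * ((1 : ℝ) * (1 : ℝ)) + ((1 : ℝ) * (1 : ℝ)) ^ 2) + 3 * ((64 * 44900 + 480 * (448 / 3 * Real.exp 2) + 1728 * (32 /
      3) + 1536) * ((7 + (1 : ℝ) * (1 : ℝ)) * (7 + (1 : ℝ) * (1 : ℝ))) + (32 * (448 / 3 * Real.exp 2) + 144 * (32 / 3) + 128) * (7 * (1 : ℝ) + (1 : ℝ)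
      * 7 + (1 : ℝ) * (1 : ℝ) * (1 : ℝ))) + ((32 * (448 / 3 * Real.exp 2) + 144 * (32 / 3) + 128) * ((64 + 1 / 3) + (1 : ℝ) * (1 : ℝ)) + (16 * (32 /
      3) + 16) * (1 : ℝ))) + 3 * ((2 * (d₀ * klE0 ^ 2 * 1 + 1 * (d₀ * klE0 ^ 2)) * ((4 + 2 * A) * (5 * π) + (4 + 4 * A) * (ρfM + 10 * π) * (5 * π)) +
      9 * (4 * B₀ * ((1 + 2 * (2 * klE0 / π)) * (2 * (5 * π)))))) * (2 * (5 * π) ^ 2) * ((64 * 44900 + 480 * (448 / 3 * Real.exp 2) + 1728 * (32 / 3)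
      + 1536) * (7 + (1 : ℝ) * (1 : ℝ)) ^ 2 + (32 * (448 / 3 * Real.exp 2) + 144 * (32 / 3) + 128) * (1 : ℝ) * (2 * 7 + (1 : ℝ) * (1 : ℝ)) + (32 *
      (448 / 3 * Real.exp 2) + 144 * (32 / 3) + 128) * (7 + (1 : ℝ) * (1 : ℝ)) + (16 * (32 / 3) + 16) * (1 : ℝ)) + 3 * (((4 * (d₀ * klE0 ^ 4 * 1 + 2 *
      (d₀ * klE0 ^ 2) * (d₀ * klE0 ^ 2) + 1 * (d₀ * klE0 ^ 4)) + 2 * (d₀ * klE0 ^ 2 * 1 + 1 * (d₀ * klE0 ^ 2))) * ((4 + 2 * A) * (5 * π) + (4 + 4 * A)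
      * (ρfM + 10 * π) * (5 * π)) ^ 2 + 2 * (d₀ * klE0 ^ 2 * 1 + 1 * (d₀ * klE0 ^ 2)) * ((4 + 4 * A) * (5 * π) ^ 2) + 4 * (d₀ * klE0 ^ 2 * 1 + 1 * (d₀
      * klE0 ^ 2)) * ((4 + 2 * A) * (5 * π) + (4 + 4 * A) * (ρfM + 10 * π) * (5 * π)) * (9 * (4 * B₀ * ((1 + 2 * (2 * klE0 / π)) * (2 * (5 * π))))) +
      9 * (4 * B₀ * ((1 + 2 * (2 * klE0 / π)) * (2 * (5 * π))) ^ 2 + 8 * B₀ ^ 2 * ((1 + 2 * (2 * klE0 / π)) * (2 * (5 * π))) ^ 2))) * (Real.sqrt 2 *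
      (5 * π)) * ((32 * (448 / 3 * Real.exp 2) + 144 * (32 / 3) + 128) * (7 + (1 : ℝ) * (1 : ℝ)) + (16 * (32 / 3) + 16) * (1 : ℝ)) + (((8 * (d₀ * klE0
      ^ 6 * 1 + 3 * (d₀ * klE0 ^ 4) * (d₀ * klE0 ^ 2) + 3 * (d₀ * klE0 ^ 2) * (d₀ * klE0 ^ 4) + 1 * (d₀ * klE0 ^ 6)) + 12 * (d₀ * klE0 ^ 4 * 1 + 2 *
      (d₀ * klE0 ^ 2) * (d₀ * klE0 ^ 2) + 1 * (d₀ * klE0 ^ 4))) * (4 + 2 * A) ^ 3 + (12 * (d₀ * klE0 ^ 4 * 1 + 2 * (d₀ * klE0 ^ 2) * (d₀ * klE0 ^ 2) +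
      1 * (d₀ * klE0 ^ 4)) + 6 * (d₀ * klE0 ^ 2 * 1 + 1 * (d₀ * klE0 ^ 2))) * (4 + 2 * A) * (4 + 4 * A) * klE0 + 2 * (d₀ * klE0 ^ 2 * 1 + 1 * (d₀ *
      klE0 ^ 2)) * (4 * klE0 ^ 2) + 216 * 9 * B₃a * ((4 * (d₀ * klE0 ^ 4 * 1 + 2 * (d₀ * klE0 ^ 2) * (d₀ * klE0 ^ 2) + 1 * (d₀ * klE0 ^ 4)) + 2 * (d₀
      * klE0 ^ 2 * 1 + 1 * (d₀ * klE0 ^ 2))) * (4 + 2 * A) ^ 2 * (2 * klE0) + 2 * (d₀ * klE0 ^ 2 * 1 + 1 * (d₀ * klE0 ^ 2)) * (4 + 4 * A) * klE0 * (2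
      * klE0)) + 216 * 9 * (d₀ * klE0 ^ 2 * 1 + 1 * (d₀ * klE0 ^ 2)) * (4 + 2 * A) * (12 * B₃a + 72 * B₃a ^ 2) * (2 * klE0) ^ 2 + 216 * 9 * (12 * B₃a
      + 216 * B₃a ^ 2) * (2 * klE0) ^ 3) + 16 * (d₀ * klE0 ^ 2 * 1 + 1 * (d₀ * klE0 ^ 2)) * (1 / 3 : ℝ)) * (5 * π) ^ 3 * (16 * (32 / 3) + 16)) +
      ((Real.sqrt 2 * (5 * π)) ^ 3 * ((128 * 3960000 + 1408 * 44900 + 7776 * (448 / 3 * Real.exp 2) + 27648 * (32 / 3) + 24576) * (7 + (1 : ℝ) * (1 :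
      ℝ)) ^ 3 + (64 * 44900 + 480 * (448 / 3 * Real.exp 2) + 1728 * (32 / 3) + 1536) * (1 : ℝ) * (3 * 7 ^ 2 + 3 * 7 * ((1 : ℝ) * (1 : ℝ)) + ((1 : ℝ) *
      (1 : ℝ)) ^ 2) + 3 * ((64 * 44900 + 480 * (448 / 3 * Real.exp 2) + 1728 * (32 / 3) + 1536) * ((7 + (1 : ℝ) * (1 : ℝ)) * (7 + (1 : ℝ) * (1 : ℝ)))
      + (32 * (448 / 3 * Real.exp 2) + 144 * (32 / 3) + 128) * (7 * (1 : ℝ) + (1 : ℝ) * 7 + (1 : ℝ) * (1 : ℝ) * (1 : ℝ))) + ((32 * (448 / 3 * Real.exp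
      2) + 144 * (32 / 3) + 128) * ((64 + 1 / 3) + (1 : ℝ) * (1 : ℝ)) + (16 * (32 / 3) + 16) * (1 : ℝ))) + 3 * ((2 * (d₀ * klE0 ^ 2 * 1 + 1 * (d₀ *
      klE0 ^ 2)) * ((2 * π) * (4 + 2 * A) + (4 + 4 * A) * (ρfM + 10 * π) * (5 * π)) + 9 * (4 * B₀ * ((1 + 2 * (2 * klE0 / π)) * (2 * (5 * π)))))) * (2
      * (5 * π) ^ 2) * ((64 * 44900 + 480 * (448 / 3 * Real.exp 2) + 1728 * (32 / 3) + 1536) * (7 + (1 : ℝ) * (1 : ℝ)) ^ 2 + (32 * (448 / 3 * Real.exp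
      2) + 144 * (32 / 3) + 128) * (1 : ℝ) * (2 * 7 + (1 : ℝ) * (1 : ℝ)) + (32 * (448 / 3 * Real.exp 2) + 144 * (32 / 3) + 128) * (7 + (1 : ℝ) * (1 :
      ℝ)) + (16 * (32 / 3) + 16) * (1 : ℝ)) + 3 * (((4 * (d₀ * klE0 ^ 4 * 1 + 2 * (d₀ * klE0 ^ 2) * (d₀ * klE0 ^ 2) + 1 * (d₀ * klE0 ^ 4)) + 2 * (d₀ *
      klE0 ^ 2 * 1 + 1 * (d₀ * klE0 ^ 2))) * ((2 * π) * (4 + 2 * A) + (4 + 4 * A) * (ρfM + 10 * π) * (5 * π)) ^ 2 + 2 * (d₀ * klE0 ^ 2 * 1 + 1 * (d₀ *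
      klE0 ^ 2)) * ((4 + 4 * A) * (5 * π) ^ 2) + 4 * (d₀ * klE0 ^ 2 * 1 + 1 * (d₀ * klE0 ^ 2)) * ((2 * π) * (4 + 2 * A) + (4 + 4 * A) * (ρfM + 10 * π)
      * (5 * π)) * (9 * (4 * B₀ * ((1 + 2 * (2 * klE0 / π)) * (2 * (5 * π))))) + 9 * (4 * B₀ * ((1 + 2 * (2 * klE0 / π)) * (2 * (5 * π))) ^ 2 + 8 * B₀
      ^ 2 * ((1 + 2 * (2 * klE0 / π)) * (2 * (5 * π))) ^ 2))) * (Real.sqrt 2 * (5 * π)) * ((32 * (448 / 3 * Real.exp 2) + 144 * (32 / 3) + 128) * (7 +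
      (1 : ℝ) * (1 : ℝ)) + (16 * (32 / 3) + 16) * (1 : ℝ)) + (((8 * (d₀ * klE0 ^ 6 * 1 + 3 * (d₀ * klE0 ^ 4) * (d₀ * klE0 ^ 2) + 3 * (d₀ * klE0 ^ 2) *
      (d₀ * klE0 ^ 4) + 1 * (d₀ * klE0 ^ 6)) + 12 * (d₀ * klE0 ^ 4 * 1 + 2 * (d₀ * klE0 ^ 2) * (d₀ * klE0 ^ 2) + 1 * (d₀ * klE0 ^ 4))) * (4 + 2 * A) ^
      3 + (12 * (d₀ * klE0 ^ 4 * 1 + 2 * (d₀ * klE0 ^ 2) * (d₀ * klE0 ^ 2) + 1 * (d₀ * klE0 ^ 4)) + 6 * (d₀ * klE0 ^ 2 * 1 + 1 * (d₀ * klE0 ^ 2))) *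
      (4 + 2 * A) * (4 + 4 * A) * klE0 + 2 * (d₀ * klE0 ^ 2 * 1 + 1 * (d₀ * klE0 ^ 2)) * (4 * klE0 ^ 2) + 216 * 9 * B₃a * ((4 * (d₀ * klE0 ^ 4 * 1 + 2
      * (d₀ * klE0 ^ 2) * (d₀ * klE0 ^ 2) + 1 * (d₀ * klE0 ^ 4)) + 2 * (d₀ * klE0 ^ 2 * 1 + 1 * (d₀ * klE0 ^ 2))) * (4 + 2 * A) ^ 2 * (2 * klE0) + 2 *
      (d₀ * klE0 ^ 2 * 1 + 1 * (d₀ * klE0 ^ 2)) * (4 + 4 * A) * klE0 * (2 * klE0)) + 216 * 9 * (d₀ * klE0 ^ 2 * 1 + 1 * (d₀ * klE0 ^ 2)) * (4 + 2 * A)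
      * (12 * B₃a + 72 * B₃a ^ 2) * (2 * klE0) ^ 2 + 216 * 9 * (12 * B₃a + 216 * B₃a ^ 2) * (2 * klE0) ^ 3) + 16 * (d₀ * klE0 ^ 2 * 1 + 1 * (d₀ * klE0
      ^ 2)) * (1 / 3 : ℝ)) * (5 * π) ^ 3 * (16 * (32 / 3) + 16))) + ρ₃ ^ 2 / 16 * (2 * (5 * π) ^ 2 * ((64 * 44900 + 480 * (448 / 3 * Real.exp 2) +
      1728 * (32 / 3) + 1536) * (7 + (1 : ℝ) * (1 : ℝ)) ^ 2 + (32 * (448 / 3 * Real.exp 2) + 144 * (32 / 3) + 128) * (1 : ℝ) * (2 * 7 + (1 : ℝ) * (1 :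
      ℝ)) + (32 * (448 / 3 * Real.exp 2) + 144 * (32 / 3) + 128) * (7 + (1 : ℝ) * (1 : ℝ)) + (16 * (32 / 3) + 16) * (1 : ℝ)) + 2 * ((2 * (d₀ * klE0 ^
      2 * 1 + 1 * (d₀ * klE0 ^ 2)) * ((2 * π) * (4 + 2 * A) + (4 + 4 * A) * (ρfM + 10 * π) * (5 * π)) + 9 * (4 * B₀ * ((1 + 2 * (2 * klE0 / π)) * (2 *
      (5 * π)))))) * (Real.sqrt 2 * (5 * π)) * ((32 * (448 / 3 * Real.exp 2) + 144 * (32 / 3) + 128) * (7 + (1 : ℝ) * (1 : ℝ)) + (16 * (32 / 3) + 16)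
      * (1 : ℝ)) + (((4 * (d₀ * klE0 ^ 4 * 1 + 2 * (d₀ * klE0 ^ 2) * (d₀ * klE0 ^ 2) + 1 * (d₀ * klE0 ^ 4)) + 2 * (d₀ * klE0 ^ 2 * 1 + 1 * (d₀ * klE0
      ^ 2))) * ((2 * π) * (4 + 2 * A) + (4 + 4 * A) * (ρfM + 10 * π) * (5 * π)) ^ 2 + 2 * (d₀ * klE0 ^ 2 * 1 + 1 * (d₀ * klE0 ^ 2)) * ((4 + 4 * A) *
      (5 * π) ^ 2) + 4 * (d₀ * klE0 ^ 2 * 1 + 1 * (d₀ * klE0 ^ 2)) * ((2 * π) * (4 + 2 * A) + (4 + 4 * A) * (ρfM + 10 * π) * (5 * π)) * (9 * (4 * B₀ *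
      ((1 + 2 * (2 * klE0 / π)) * (2 * (5 * π))))) + 9 * (4 * B₀ * ((1 + 2 * (2 * klE0 / π)) * (2 * (5 * π))) ^ 2 + 8 * B₀ ^ 2 * ((1 + 2 * (2 * klE0 /
      π)) * (2 * (5 * π))) ^ 2))) * (16 * (32 / 3) + 16))) := ⟨_, rfl⟩
  have h𝒜c0 : 0 < 𝒜c := by rw [h𝒜c]; positivity
  -- the sectional step constant (`secCov_scalar_le`) and the weight rate `min ρ σ = 1`
  obtain ⟨cN, hcN⟩ : ∃ y : ℝ, y = ((Real.sqrt 2 * ((1 + (4 + 4 * A) * ρfM ^ 2) / (2 * B.rhomin - 4 * A)) / π + 2) * (Real.sqrt 2 * (2 * ρfM) / π + 2)) := ⟨_, rfl⟩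
  have hcN0 : 0 ≤ cN := by rw [hcN]; positivity
  obtain ⟨𝒦, h𝒦⟩ : ∃ y : ℝ, y = 2 * (Real.sqrt (524288 * (1 / 1 + 1) * ((1 + 4 * Real.sqrt 2) ^ 2 * ((2 * Real.sqrt 2 / ρ + 2) * (2 * Real.sqrt 2 / ρ₃ + 2)) + (1 / ρ + 1) ^ 2)) * Real.sqrt (24 * cN) * 𝒜c) := ⟨_, rfl⟩
  have h𝒦0 : 0 ≤ 𝒦 := by rw [h𝒦]; positivity
  refine ⟨𝒦, min ρ σ, h𝒦0, lt_min hρ0 hσ0, ?_⟩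
  intro R hR c U hc hcle hU hUle hG3U β hβmin hβc μ hμ L M _ _ hLβ hMβ Ko Kn i hfro _ h3o _ hl3o _ G₀ hG₀pos hG₀1 hw₀ hw₁ hw₂ hw₃ m hnfN hwin Λw hΛw0 hΛwρ
  have hβ0 : 0 < β := pos_of_klBetaMin_le hβmin
  have hβ128 : 128 ≤ β := by simpa [klBetaMin] using hβmin
  have hL0 : (0 : ℝ) < L := lt_of_lt_of_le (by positivity) hLβ
  have hL1r : (1 : ℝ) ≤ L := le_trans (one_le_pow₀ (by linarith only [hβ128] : (1 : ℝ) ≤ β)) hLβ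
  have hM0 : (0 : ℝ) < M := lt_of_lt_of_le hβ0 hMβ
  have hU1 : U ≤ 1 := hUle.trans (min_le_left _ _)
  have hU2 : U ^ 2 ≤ 1 := pow_le_one₀ hU.le hU1
  -- the capped order-three slope `Gfr₃ U² ≤ 1`
  have hG3U2 : R.Gfr 3 * U ^ 2 ≤ 1 := by
    calc R.Gfr 3 * U ^ 2 = (R.Gfr 3 * U) * U := by ring
      _ ≤ 1 * 1 := mul_le_mul hG3U hU1 hU.le zero_le_one
      _ = 1 := one_mul _
  have hR3 : 0 ≤ R.Gfr 3 := hR 3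
  -- the frames' `C²` size is `≤ A = κ₀/4`
  have hlog : 1 ≤ Real.log 4 := by
    have h4 : Real.exp 1 ≤ 4 := by have := Real.exp_one_lt_d9; norm_num at this; linarith
    calc (1 : ℝ) = Real.log (Real.exp 1) := (Real.log_exp 1).symm
      _ ≤ Real.log 4 := Real.log_le_log (Real.exp_pos 1) h4
  have hAK : ∀ K : TrigPolyC4v, FrameOK R U (nScales β) μ K → ∀ p : Momentum, ∀ k ≤ 2, ‖iteratedFDeriv ℝ k (frameShift K) p‖ ≤ A := by
    intro K hK p k hk
    refine (norm_iteratedFDeriv_frameShift_le_of_frameOK_regime hR hc.le hβmin hβc hK p hk).trans ?_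
    have h0 := hR 0; have h1 := hR 1; have h2 := hR 2
    have hUk : U ≤ κ₀ / (24 * (R.Gfr 0 + R.Gfr 1 + 1)) := hUle.trans (min_le_right _ _)
    rw [abs_of_pos hU]
    have hU2' : U ^ 2 ≤ U := by nlinarith only [hU, hU1]
    have hA1 : 2 * R.Gfr 0 * U + 2 * R.Gfr 1 * U ^ 2 ≤ 2 * (R.Gfr 0 + R.Gfr 1 + 1) * U := by
      have := mul_le_mul_of_nonneg_left hU2' h1
      linarith only [this, hU.le]
    have hB1 : 2 * (R.Gfr 0 + R.Gfr 1 + 1) * U ≤ κ₀ / 12 := by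
      have hpos : 0 < 24 * (R.Gfr 0 + R.Gfr 1 + 1) := by positivity
      have := (le_div_iff₀ hpos).mp hUk
      linarith only [this]
    have hC1 : R.Gfr 2 * (c / Real.log 4) ≤ R.Gfr 2 * c := mul_le_mul_of_nonneg_left (div_le_self hc.le hlog) h2
    have hD1 : R.Gfr 2 * c ≤ κ₀ / 12 := by
      have hpos : 0 < 12 * (R.Gfr 2 + 1) := by positivity
      have := (le_div_iff₀ hpos).mp hcle
      linarith only [this, hc.le]
    rw [hAdef]; linarith only [hA1, hB1, hC1, hD1, hκ₀pos]
  have hAo := hAK Ko hfro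
  have hμ' := hμ
  simp only [klWindowC, Set.mem_Icc] at hμ'
  have hμlo : -(21 / 20 : ℝ) ≤ μ := by rw [← show (-1.05 : ℝ) = -(21 / 20) by norm_num]; exact hμ'.1
  have hμhi : μ ≤ -(3 / 20 : ℝ) := by rw [← show (-0.15 : ℝ) = -(3 / 20) by norm_num]; exact hμ'.2
  have he0 : klE0 = 1 / 32 := rfl
  have hgap : klE0 + A + (1 / 10 : ℝ) ^ 2 < -μ := by rw [he0, hAdef]; linarith only [hμhi, hκ₀40]
  have h3 : klE0 + A - μ ≤ 3 := by rw [he0, hAdef]; linarith only [hμlo, hκ₀40]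
  have hlo : (-(6 / 5) : ℝ) ≤ μ - A - klE0 := by rw [he0, hAdef]; linarith only [hμlo, hκ₀40]
  have hhi : μ + A + klE0 ≤ -(1 / 10) := by rw [he0, hAdef]; linarith only [hμhi, hκ₀40]
  have hADt : 2 * A < B.Dtmin := by rw [hAdef]; linarith
  have hρA : 4 * A < 2 * B.rhomin := by rw [hAdef]; linarith
  have hK₁o : ∀ p, ‖fderiv ℝ (frameLevel μ Ko) p‖ ≤ 7 := fun p => norm_fderiv_frameLevel_le_of_frameOK hfro p
  have hK₂o : ∀ p, ‖iteratedFDeriv ℝ 2 (frameLevel μ Ko) p‖ ≤ 7 := fun p => norm_iteratedFDeriv_two_frameLevel_le_of_frameOK hfro p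
  have hB₁ : ∀ x, |deriv salmhoferCutoff x| ≤ 32 / 3 := klcd_abs_deriv_salmhoferCutoff_le_sharp
  have hB₂ : ∀ x, |deriv (deriv salmhoferCutoff) x| ≤ 448 / 3 * Real.exp 2 := klsd_abs_deriv2_salmhoferCutoff_le
  have hB₃ : ∀ x, |deriv (deriv (deriv salmhoferCutoff)) x| ≤ 44900 := fun x => (kltd_abs_deriv3_salmhoferCutoff_lt x).le
  have hB₄ : ∀ x, |deriv (deriv (deriv (deriv salmhoferCutoff))) x| ≤ 3960000 := fun x => (kltd_abs_deriv4_salmhoferCutoff_lt x).le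
  -- the regime scalars at depth `m`, offset `j`, reference scale `4^i`
  have hswpos := sectorWidth_pos (m + 1)
  have hanti : ∀ {a b : ℕ}, a ≤ b → klScale klE0 b ≤ klScale klE0 a := fun hab' => by
    unfold klScale; exact mul_le_mul_of_nonneg_left (inv_anti₀ (by positivity) (pow_le_pow_right₀ (by norm_num) hab')) he.le
  obtain ⟨hMm, hM', hπβ, hLN, hL1, hLz2, hL40, hN2⟩ := telRegime_lattice hβmin hLβ hMβ hnfN hγ4
  obtain ⟨hlamΛ, hΛ₁, hNΛ, hx₀W, hY1, hY, hYW, hΛW, hΛx, hlx2, hlx, hlam1, hΛlam⟩ := telRegime_refscale (m := m) (j := j) (i₀ := i) hwin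
  obtain ⟨hwsi, hζ, hw, hsw⟩ := telRegime_angular m
  have hΛs : 0 < klScale klE0 (m + 1 + j) := klth_klScale_pos _
  have hlam0 : 0 < klScale klE0 m := klth_klScale_pos _
  have hΛe : ∀ k, klScale klE0 k ≤ klE0 := fun k => klScale_le_e0 he.le k
  have hΛs1 : klScale klE0 (m + 1 + j) ≤ 1 := hΛlam.trans hlam1
  have hΛΛ' : klScale klE0 (m + 1 + j) ≤ klScale klE0 (m + j) := hanti (by omega)
  have hx₀1 : (1 : ℝ) ≤ (4 : ℝ) ^ i := one_le_pow₀ (by norm_num)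
  have hx₀0 : (0 : ℝ) < (4 : ℝ) ^ i := by positivity
  -- the capped frame data at depth `4^i`
  have h3o'' : ∀ p : Momentum, ‖iteratedFDeriv ℝ 3 (frameShift Ko) p‖ ≤ 1 / 3 * (4 : ℝ) ^ i := fun p => (h3o p).trans (by nlinarith only [hG3U2, hx₀0, hR3])
  have hl3o' : ∀ p : Momentum, ‖iteratedFDeriv ℝ 3 (frameLevel μ Ko) p‖ ≤ (64 + 1 / 3) * (4 : ℝ) ^ i := fun p => (hl3o p).trans (by nlinarith only [hG3U2, hx₀0, hx₀1, hR3])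
  have ha3o : 1 / 3 * (4 : ℝ) ^ i * klScale klE0 m ^ 2 ≤ 1 / 3 * klScale klE0 m ^ 2 * (4 : ℝ) ^ i := le_of_eq (by ring)
  -- the increment constants: all slots `= G₀ ≤ 1`
  have hG₀g : G₀ ≤ 1 := hG₀1
  have hGγ : G₀ = 1 * G₀ := (one_mul G₀).symm
  have hρf0 : 0 ≤ (klScale klE0 m + B.smax * B.Dtmin * (3 * sectorWidth (m + 1) / 4)) / (B.Dtmin - 2 * A) + π * Real.sqrt 2 * (1 + (4 + 2 * A) / (B.Dtmin - 2 * A)) * sectorWidth (m + 1) := by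
    positivity
  have hρfb : (klScale klE0 m + B.smax * B.Dtmin * (3 * sectorWidth (m + 1) / 4)) / (B.Dtmin - 2 * A) + π * Real.sqrt 2 * (1 + (4 + 2 * A) / (B.Dtmin - 2 * A)) * sectorWidth (m + 1) ≤ ρfM := by
    rw [hρfM]; gcongr; exact hΛe m
  have hs₀pos : 0 < σ * klScale klE0 (m + 1 + j) * β / M := by positivity
  have hs₀1 : σ * klScale klE0 (m + 1 + j) * β ≤ M := by
    calc σ * klScale klE0 (m + 1 + j) * β ≤ 1 * 1 * β := by gcongr
      _ = β := by ring
      _ ≤ M := hMβ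
  have hsM' : σ * klScale klE0 (m + 1 + j) * β / M * (2 * (M : ℝ)) ≤ 2 * σ * klScale klE0 (m + 1 + j) * β := by
    rw [show σ * klScale klE0 (m + 1 + j) * β / M * (2 * (M : ℝ)) = 2 * σ * klScale klE0 (m + 1 + j) * β by field_simp]
  have hM2 : (0 : ℝ) < 2 * (M : ℝ) := by positivity
  -- the tower's weight: `Λ_w·4^i ≤ 1 = ρ` gives `Λ_w ≤ 4^{−i}·ρ`, `D_w := 4^{−i}`
  have hDw : (1 : ℝ) ≤ 1 / (4 : ℝ) ^ i * (4 : ℝ) ^ i := by rw [one_div_mul_cancel hx₀0.ne']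
  have hdom₁' : Λw ≤ 1 / (4 : ℝ) ^ i * ρ := by
    rw [one_div_mul_eq_div, le_div_iff₀ hx₀0]; exact hΛwρ.trans (min_le_left _ _)
  have hR₀0 : 2 * (2 * (2 : ℝ) + 1) * ((0 : ℕ) : ℝ) < (L : ℝ) := by push_cast; linarith
  have hcast : ((2 * M : ℕ) : ℝ) = 2 * (M : ℝ) := by push_cast; ring
  -- brick S4: the SECTIONAL covariance piece at `(K, K′) := (K_o, K_n)`, `x₀ := 4^i`, `D_w := 4^{−i}`, `s₀ := 1`
  have hC := secRowWt_sliceCT_covDefect_pieceJets_le (B := B) (K := Ko) (K' := Kn) (A := A) (x := (4 : ℝ) ^ i) (x₀ := (4 : ℝ) ^ i) (hx₀ := hx₀1) (hx₀x := le_rfl) (hA := hAo) (hADt := hADt)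
    (e₀ := klE0) (z := 1 / 10) (he := he) (hz := (by norm_num : (0 : ℝ) < 1 / 10)) (hz1 := (by norm_num : (1 / 10 : ℝ) ≤ 1)) (hgap := hgap) (h3 := h3) (hlo := hlo) (hhi := hhi) (hβ := hβ0) (hρA := hρA) (m := m) (hMm := hMm)
    (d := d₀) (hd := hd₀) (hd1 := hd₀1) (hd2 := hd₀2) (hd3 := hd₀3) (A₃ := 1 / 3 * (4 : ℝ) ^ i) (a₃s := 1 / 3 * klScale klE0 m ^ 2) (hA3 := h3o'') (ha3 := ha3o) (ha3s := (by positivity)) (Ba := B₀) (hB0 := hB₀0) (hB := hB₀)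
    (Ba3 := B₃a) (hB30 := hB₃a0) (hB3 := hB₃a) (Λ := klScale klE0 (m + 1 + j)) (Λ' := klScale klE0 (m + j)) (hΛ := hΛs) (hΛΛ' := hΛΛ') (K₁ := 7) (K₂ := 7) (K₃s := 64 + 1 / 3) (hK₁ := hK₁o) (hK₂ := hK₂o) (hK₃ := hl3o')
    (hK₃s := (by norm_num)) (B₁ := 32 / 3) (B₂ := 448 / 3 * Real.exp 2) (B₃ := 44900) (B₄ := 3960000) (hB₁ := hB₁) (hB₂ := hB₂) (hB₃ := hB₃) (hB₄ := hB₄) (G₀ := G₀) (Gi₁ := G₀) (Gi₂ := G₀) (Gi₃ := G₀)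
    (Nr := 2) (hNr := (le_refl (2 : ℝ))) (hLz := hLz2) (R₀ := 0) (hR₀ := hR₀0) (hℓ₁ := rfl) (hℓ := rfl) (hρf := rfl) (hG₁ := rfl) (hG₂ := rfl) (hG₃ := rfl) (hKp := rfl) (hwsi := rfl) (hτt := rfl) (hAe1 := rfl) (hAe2 := rfl) (hAn1 := rfl)
    (hAn2 := rfl) (hAv1 := rfl) (hAv2 := rfl) (hX₀s := rfl) (hX₁s := rfl) (hX₂s := rfl) (hX₃s := rfl) (s₀ := 1) (ρ := ρ) (ρ₃ := ρ₃) (hs₀ := one_pos) (hρ := hρ0) (hρ₃ := hρ₃0)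
    (hκA := rfl) (hκB := rfl) (hAΔs := rfl) (hG₀n := hG₀pos.le) (hGi₁n := hG₀pos.le) (hGi₂n := hG₀pos.le) (hGi₃n := hG₀pos.le) (hw₀ := hw₀) (hw₁ := hw₁) (hw₂ := hw₂) (hw₃ := hw₃)
    (hΛw := hΛw0) (Dw := 1 / (4 : ℝ) ^ i) (hDw := hDw) (hdom₁ := hdom₁')
  -- the amplitude at the reference scale `4^i` and the step scalar (its nonnegative family slot is discarded)
  have hamp := covTel_amp_pack (lam := klScale klE0 m) (Λ := klScale klE0 (m + 1 + j)) (c := β * (L : ℝ) ^ 2) (β := β) (P2M := 2 * (M : ℝ)) (Lr := (L : ℝ)) (x₀ := (4 : ℝ) ^ i) (ε₂ := 4 + 4 * A) (Kb₁ := 7) (Kb₂ := 7) (K₃s := 64 + 1 / 3)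
    (B₁ := 32 / 3) (B₂ := 448 / 3 * Real.exp 2) (B₃ := 44900) (B₄ := 3960000) (ρ := ρ) (ρ₃ := ρ₃) (s₀ := σ * klScale klE0 (m + 1 + j) * β / M) (hℓ₁ := rfl) (hℓ := rfl) (hGp₁ := rfl) (hGp₂ := rfl) (hGp₃ := rfl) (hAe1 := rfl) (hAe2 := rfl) (hAn1 := rfl)
    (hAn2 := rfl) (hAv1 := rfl) (hAv2 := rfl) (hX₀s := rfl) (hX₁s := rfl) (hX₂s := rfl) (hX₃s := rfl) (hTts := rfl) (hκA := rfl) (hκB := rfl) (hAΔs := rfl) (hs₀ := hs₀pos) (hρ := hρ0) (hΛ := hΛs) (hΛlam := hΛlam) (hlam1 := hlam1) (hc := (by positivity))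
    (hβ := hβ0) (hLr := hL1r) (hx₀ := hx₀1) (hΛx := hΛx) (hlx := hlx) (hA := hA0.le) (hd := hd₀) (hBa := hB₀0) (hBa3 := hB₃a0) (hε₂ := (by positivity)) (he := he.le) (hG₀ := hG₀pos.le) (hG₀g := hG₀g) (hGi₁ := hGγ) (hGi₂ := hGγ) (hGi₃ := hGγ)
    (hγ₁ := zero_le_one) (hγ₂ := zero_le_one) (hγ₃ := zero_le_one) (hKb₁ := (by norm_num)) (hKb₂ := (by norm_num)) (hK₃s := (by norm_num)) (hB₁ := (by norm_num)) (hB₂ := (by positivity)) (hB₃ := (by norm_num)) (hB₄ := (by norm_num)) (hρf0 := hρf0) (hρfM := hρfb)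
    (hwsi0 := (by positivity)) (hw := hwsi) (𝔞₃ := 1 / 3) (ha₃s := le_rfl) (h𝔞₃ := (by norm_num)) (hP2M := hM2) (hsM := hsM')
  rw [← h𝒜c] at hamp
  -- the sectional amplitude is the full one minus its nonnegative time term
  have hampS := le_of_add_six_le hamp (by positivity)
  -- the sectional cell count and the reference-scale `Ŵ`
  have hNs : Real.sqrt (24 * (L : ℝ) ^ 2 * ((Real.sqrt 2 * L * ((klScale klE0 m + (4 + 4 * A) * ((klScale klE0 m + B.smax * B.Dtmin * (3 * sectorWidth (m + 1) / 4)) / (B.Dtmin - 2 * A) + π * Real.sqrt 2 * (1 + (4 + 2 * A) / (B.Dtmin - 2 * A)) * sectorWidth (m + 1)) ^ 2) / (2 * B.rhomin - 4 * A)) / π + 2) * (Real.sqrt 2 * L * (2 * ((klScale klE0 m + B.smax * B.Dtmin * (3 * sectorWidth (m + 1) / 4)) / (B.Dtmin - 2 * A) + π * Real.sqrt 2 * (1 + (4 + 2 * A) / (B.Dtmin - 2 * A)) * sectorWidth (m + 1))) / π + 2))) ≤ (L : ℝ) ^ 2 * Real.sqrt (24 * cN) := by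
    refine (sqrt_secCellCount_le hL1r (by positivity) (by positivity)).trans (mul_le_mul_of_nonneg_left ?_ (by positivity))
    rw [hcN]
    gcongr
  have hWx : Real.sqrt (524288 * (1 / 1 + 1) * ((1 + 4 * Real.sqrt 2) ^ 2 * ((2 * Real.sqrt 2 / (ρ / (4 : ℝ) ^ i) + 2) * (2 * Real.sqrt 2 / (ρ₃ / (4 : ℝ) ^ i) + 2)) + (1 / (ρ / (4 : ℝ) ^ i) + 1) ^ 2)) ≤ (4 : ℝ) ^ i * Real.sqrt (524288 * (1 / 1 + 1) * ((1 + 4 * Real.sqrt 2) ^ 2 * ((2 * Real.sqrt 2 / ρ + 2) * (2 * Real.sqrt 2 / ρ₃ + 2)) + (1 / ρ + 1) ^ 2)) := by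
    have h := Real.sqrt_le_sqrt (telW_ref_le (s₀ := 1) (x₀ := (4 : ℝ) ^ i) one_pos hx₀1 hρ0 hρ₃0)
    rw [Real.sqrt_mul (sq_nonneg ((4 : ℝ) ^ i)), Real.sqrt_sq hx₀0.le] at h
    exact h
  have hTs := secCov_scalar_le (lam := klScale klE0 m) (β := β) (L := (L : ℝ)) (Λ := klScale klE0 (m + 1 + j)) (x := (4 : ℝ) ^ i)
    (W := Real.sqrt (524288 * (1 / 1 + 1) * ((1 + 4 * Real.sqrt 2) ^ 2 * ((2 * Real.sqrt 2 / ρ + 2) * (2 * Real.sqrt 2 / ρ₃ + 2)) + (1 / ρ + 1) ^ 2))) (Wx := Real.sqrt (524288 * (1 / 1 + 1) * ((1 + 4 * Real.sqrt 2) ^ 2 * ((2 * Real.sqrt 2 / (ρ / (4 : ℝ) ^ i) + 2) * (2 * Real.sqrt 2 / (ρ₃ / (4 : ℝ) ^ i) + 2)) + (1 / (ρ / (4 : ℝ) ^ i) + 1) ^ 2))) (Ns := Real.sqrt (24 * (L : ℝ) ^ 2 * ((Real.sqrt 2 * L * ((klScale klE0 m + (4 + 4 * A) * ((klScale klE0 m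 + B.smax * B.Dtmin * (3 * sectorWidth (m + 1) / 4)) / (B.Dtmin - 2 * A) + π * Real.sqrt 2 * (1 + (4 + 2 * A) / (B.Dtmin - 2 * A)) * sectorWidth (m + 1)) ^ 2) / (2 * B.rhomin - 4 * A)) / π + 2) * (Real.sqrt 2 * L * (2 * ((klScale klE0 m + B.smax * B.Dtmin * (3 * sectorWidth (m + 1) / 4)) / (B.Dtmin - 2 * A) + π * Real.sqrt 2 * (1 + (4 + 2 * A) / (B.Dtmin - 2 * A)) * sectorWidth (m + 1))) / π + 2)))) (cN := cN) (G₀ := G₀) (𝒜 := 𝒜c)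
    hlam0 hlam1 hβ128 hL1r hΛs hx₀1 (Real.sqrt_nonneg _) (Real.sqrt_nonneg _) hWx (Real.sqrt_nonneg _) hNs hG₀pos.le h𝒜c0.le hampS
  have efin : ∀ T : ℝ, 2 * (1 / (4 : ℝ) ^ i * (4 : ℝ) ^ i * T) = 2 * T := fun T => by rw [one_div_mul_cancel hx₀0.ne', one_mul]
  intro X t ℓ
  refine (hC X t ℓ).trans ?_
  rw [efin, h𝒦]
  have e2 : 2 * (Real.sqrt (524288 * (1 / 1 + 1) * ((1 + 4 * Real.sqrt 2) ^ 2 * ((2 * Real.sqrt 2 / ρ + 2) * (2 * Real.sqrt 2 / ρ₃ + 2)) + (1 / ρ + 1) ^ 2)) * Real.sqrt (24 * cN) * 𝒜c) * G₀ / (klScale klE0 (m + 1 + j) ^ 2 * (4 : ℝ) ^ i) =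
      2 * ((Real.sqrt (524288 * (1 / 1 + 1) * ((1 + 4 * Real.sqrt 2) ^ 2 * ((2 * Real.sqrt 2 / ρ + 2) * (2 * Real.sqrt 2 / ρ₃ + 2)) + (1 / ρ + 1) ^ 2)) * Real.sqrt (24 * cN) * 𝒜c) * G₀ / (klScale klE0 (m + 1 + j) ^ 2 * (4 : ℝ) ^ i)) := by ring
  rw [e2]
  exact mul_le_mul_of_nonneg_left hTs (by norm_num)

end Summit.HubbardSuperconductivity.HubbardSuperconductivity.Theorems.TorusFourierL2

end
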